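import Summits.BirchSwinnertonDyer.BirchSwinnertonDyer.Theorems.ClassRecordThreeEulerHalvesAtThreeShimuraInertSavingBudgetSetAnchor
import Summits.BirchSwinnertonDyer.BirchSwinnertonDyer.Theorems.ClassRecordThreeEulerHalvesAtThreeTwinLowerSupplyExtraSet
import HarnessLib

/-!
# Route `ClassRecordThree` (rung K2@3), crux 5 `EulerHalvesAtThree` (item stmt-BirchSwinnertonDyer-19109, routes `ClassRecordThree` ∕
# `KolyvaginRoadThree`): the TWIN-LOWER SUPPLY with an INERT EXTRA SET `C` on the (ram) SIDE — from Friedberg–Hoffstein with inertness at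
# `S ∪ C` and Skinner 2016 Thm. C (cell `bsd-stepL`, seat `bsd-stepL-tam3-p1` g19, LINE OWNER of 19109;
# `--supports stmt-BirchSwinnertonDyer-19109 --as helper`)

WHY. Sibling of `…TwinLowerSupplyExtraSet` (p660419: the ¬(ram) supply from the X11a lower half). On a pair WITH a (ram) witness `ℓ₀` the
twist at the (F4)-frame is an X11a-type rank-0 curve WITH a (ram) witness, so Skinner 2016 Thm. C supplies its `≥`-half directly — the (ram)
half of p659752's proof, cut out in SUPPLY form, so that ONE image-free budget-set core (p660279 for configuration (A1),
`…ShimuraInertBudgetSetTwinLowerD` for (A0)) serves both sides of bsd-idea-10's Cartan kernel.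

HONEST FRAMING: ONE THEOREM (no definition, no named fact, no `sorry`); CONDITIONAL on `hSk`, `hGZK`, `hmod`, `hnf` and the (F4)-type binder;
nothing is asserted about any curve; no census label moves (T7); item 19109 is NOT closed. BSD is proved for no curve.
References: [Skinner2016PacificMC] Thm. C; [FriedbergHoffstein1995] Thm. B; [SilvermanAEC2009] VII.5 Prop. 5.1(b), X.5 Cor. 5.4.
-/

noncomputable section

open scoped Classical

open WeierstrassCurve NumberField IsDedekindDomain Literature.NumberTheory.EllipticCurves
  Rat.HeightOneSpectrum CongruenceSubgroup
  Literature.NumberTheory.EllipticCurves.ModularForms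
  Literature.NumberTheory.EllipticCurves.Rank1Residual
  Literature.NumberTheory.EllipticCurves.Rank1Residual.Typed
  Literature.NumberTheory.EllipticCurves.Wuthrich2014
  Literature.NumberTheory.EllipticCurves.BalakrishnanEtAl2019
  Literature.NumberTheory.QuadraticFields.Quadratic
  Literature.NumberTheory.EllipticCurves.BarriosEtAl2025
  Literature.NumberTheory.Automorphic
  Summit.BirchSwinnertonDyer.Rank1Residual
  Summit.BirchSwinnertonDyer.Rank1Residual.X11b

-- the cell's Theorems namespace repeats the summit name (Summit.<Summit>.<Problem>), as in every sibling file
set_option linter.dupNamespace false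

namespace Summit.BirchSwinnertonDyer.BirchSwinnertonDyer.Theorems

/-! ### §1. The supply with `T ∪ C` inert on the (ram) side: Friedberg–Hoffstein (F4) + Skinner 2016 Thm. C -/

/-- **The TWIN-LOWER SUPPLY with an INERT EXTRA SET `C` ⟸ Friedberg–Hoffstein with inertness at `S ∪ C` ∧ Skinner 2016 Thm. C, on an X11b pair
WITH a (ram) witness `ℓ₀`** (`p` odd, `ρ̄_{E,p}` irreducible). At the (F4)-frame a global minimal model `Wd` of the twist is multiplicative at
`p` (inert in `T` or split), `E^{d}[p]` is irreducible, and `ℓ₀` is a (ram) witness of `Wd` (inert odd ∕ inert `2` ∕ split cases: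
`ram_twist_of_inert_witness{,_two}`, `hasMultiplicativeReductionAtPrime_quadraticTwist_iff`, `padicValInt_minimalDiscriminantInt_twist_eq`;
`ℓ₀ ∉ C` since `C` is additive); Skinner 2016 Thm. C gives the twist's `≥`-half in the displayed shape. The (ram)-side sibling of §2; output
= the `hTL` binder of the budget-set twin-lower cores (p660279 (A1), `…ShimuraInertBudgetSetTwinLowerD` (A0)). CONDITIONAL on `hSk`, `hGZK`,
`hmod`, `hnf`, `hFHC`. [cite: Skinner2016PacificMC, Thm. C (§1)] [cite: FriedbergHoffstein1995, Thm. B] [cite: SilvermanAEC2009, X.5 Cor. 5.4] -/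
theorem fhTwinLowerSupplyExtraSet_of_friedbergHoffsteinExtraSet_of_skinnerC_of_ram
    (hSk : Skinner2016.thmC_padicValRat_bsd_rank_zero)
    (hGZK : rank_eq_analyticRank_of_analyticRank_le_one) (hmod : hasEntireLFunction_rat)
    (hnf : exists_isNewformOf)
    (hFHC : ∀ (W : WeierstrassCurve ℚ) [W.IsElliptic], W.rootNumber = -1 →
      ∀ (S C : Finset ℕ), (∀ ℓ ∈ S, ∃ _ : Fact ℓ.Prime, W.HasMultiplicativeReductionAtPrime ℓ) →
        Even S.card →
        (∀ q ∈ C, ∃ _ : Fact q.Prime, q ^ 2 ∣ W.conductorNorm ℤ ∧ ¬ q ^ 3 ∣ W.conductorNorm ℤ) →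
      ∀ B : ℕ, ∃ (K : Type) (_ : Field K) (_ : NumberField K),
        IsImaginaryQuadratic K ∧ B < (NumberField.discr K).natAbs ∧
          (∀ ℓ ∈ S ∪ C, ((Ideal.span {(ℓ : ℤ)}).primesOver (𝓞 K)).ncard = 1 ∧
            ¬ (ℓ : ℤ) ∣ NumberField.discr K) ∧
          (∀ ℓ : ℕ, ℓ.Prime → ℓ ∣ W.conductorNorm ℤ → ℓ ∉ S → ℓ ∉ C →
            ((Ideal.span {(ℓ : ℤ)}).primesOver (𝓞 K)).ncard = 2) ∧
          (W.quadraticTwist (NumberField.discr K : ℚ)).entireLFunction 1 ≠ 0)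
    (W : WeierstrassCurve ℚ) [W.IsElliptic] [W.IsGloballyMinimal] (p : ℕ) [Fact p.Prime]
    (hX : ClassX11b W p)
    {ℓ₀ : ℕ} [Fact ℓ₀.Prime] (hℓ₀p : ℓ₀ ≠ p) (hmult₀ : Mult W ℓ₀)
    (hram₀ : ¬ p ∣ padicValInt ℓ₀ W.minimalDiscriminantInt)
    (C : Finset ℕ)
    (hCsq : ∀ q ∈ C, ∃ _ : Fact q.Prime, q ^ 2 ∣ W.conductorNorm ℤ ∧ ¬ q ^ 3 ∣ W.conductorNorm ℤ) :
    ∀ (T : Finset ℕ), (∀ ℓ ∈ T, ∃ _ : Fact ℓ.Prime, Mult W ℓ) → Even T.card →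
      ∃ (K : Type) (_ : Field K) (_ : NumberField K)
        (Wd : WeierstrassCurve ℚ) (_ : Wd.IsElliptic) (_ : Wd.IsGloballyMinimal) (Cd : VariableChange ℚ),
        IsImaginaryQuadratic K ∧ 4 < (NumberField.discr K).natAbs ∧
        (∀ ℓ ∈ T ∪ C, ((Ideal.span {(ℓ : ℤ)}).primesOver (𝓞 K)).ncard = 1 ∧ ¬ (ℓ : ℤ) ∣ NumberField.discr K) ∧
        (∀ ℓ : ℕ, ℓ.Prime → ℓ ∣ W.conductorNorm ℤ → ℓ ∉ T → ℓ ∉ C →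
          ((Ideal.span {(ℓ : ℤ)}).primesOver (𝓞 K)).ncard = 2) ∧
        (W.quadraticTwist (NumberField.discr K : ℚ)).entireLFunction 1 ≠ 0 ∧
        Cd • W.quadraticTwist (NumberField.discr K : ℚ) = Wd ∧
        ∃ q : ℚ, Wd.entireLFunction 1 / (Wd.realPeriodRat : ℂ) = (q : ℂ) ∧
          padicValRat p q ≤ (padicValNat p Wd.shaOrder : ℤ) + padicValNat p Wd.tamagawaProduct -
            2 * padicValNat p Wd.torsionOrder := by
  intro T hTmult hTeven
  have hp : p.Prime := Fact.out
  obtain ⟨hr, hp2, hmult, hirr⟩ := id hX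
  -- the sign of the functional equation is `−1` (modularity, `r_an = 1`)
  have hw : W.rootNumber = -1 := by
    rw [WeierstrassCurve.rootNumber_eq_neg_one_pow_analyticRank_of_exists_isNewformOf hnf W, hr]
    norm_num
  -- the (F4)-frame: `T ∪ C` inert, every other bad prime split, `|d_K| > 4`
  obtain ⟨K, _, _, hK, hdisc, hinertTC, hsplitN, hLt⟩ := hFHC W hw T C hTmult hTeven hCsq 4
  have h2 := hK.1
  have hinert : ∀ ℓ ∈ T, ((Ideal.span {(ℓ : ℤ)}).primesOver (𝓞 K)).ncard = 1 ∧ ¬ (ℓ : ℤ) ∣ NumberField.discr K :=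
    fun ℓ hℓ ↦ hinertTC ℓ (Finset.mem_union_left C hℓ)
  have hnotMultC : ∀ (q : ℕ) [Fact q.Prime], q ∈ C → ¬ W.HasMultiplicativeReductionAtPrime q := by
    intro q hqF hq hm
    obtain ⟨_, h2', -⟩ := hCsq q hq
    exact not_sq_dvd_conductorNorm_of_mult W q hm h2'
  have hTin : ∀ ℓ ∈ T, ∃ _ : Fact ℓ.Prime, Mult W ℓ ∧
      ((ℓ ≠ 2 ∧ jacobiSym (NumberField.discr K) ℓ = -1) ∨ (ℓ = 2 ∧ NumberField.discr K % 8 = 5)) := by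
    intro ℓ hℓ
    obtain ⟨hℓF, hm⟩ := hTmult ℓ hℓ
    obtain ⟨hn, hd⟩ := hinert ℓ hℓ
    refine ⟨hℓF, hm, ?_⟩
    have hn' : ((Ideal.span {(ℓ : ℤ)}).primesOver (𝓞 K)).ncard ≠ 2 := by rw [hn]; decide
    by_cases hℓ2 : ℓ = 2
    · subst hℓ2
      have hn2 : ((Ideal.span {(2 : ℤ)}).primesOver (𝓞 K)).ncard ≠ 2 := by
        simpa only [Nat.cast_ofNat] using hn'
      have hd2 : ¬ (2 : ℤ) ∣ NumberField.discr K := by simpa only [Nat.cast_ofNat] using hd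
      exact Or.inr ⟨rfl, discr_emod_eight_eq_five_of_ncard_ne_two h2 hn2 hd2⟩
    · exact Or.inl ⟨hℓ2, jacobiSym_discr_eq_neg_one_of_ncard_ne_two h2 hℓF.out hℓ2 hn' hd⟩
  have hsplit : ∀ (ℓ : ℕ) [Fact ℓ.Prime], ¬ W.HasGoodReductionAtPrime ℓ → ℓ ∉ T → ℓ ∉ C →
      IsSquare (algebraMap ℚ ℚ_[ℓ] (NumberField.discr K : ℚ)) := by
    intro ℓ hℓF hg hℓT hℓC
    have hℓN : ℓ ∣ W.conductorNorm ℤ := (W.dvd_conductorNorm_iff_not_hasGoodReductionAtPrime ℓ).mpr hg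
    exact isSquare_discr_padic_of_ncard_eq_two h2 ℓ (hsplitN ℓ hℓF.out hℓN hℓT hℓC)
  -- a globally minimal model of the twist
  have hD0 : (NumberField.discr K : ℚ) ≠ 0 := by exact_mod_cast NumberField.discr_ne_zero K
  haveI hEt : (W.quadraticTwist (NumberField.discr K : ℚ)).IsElliptic :=
    W.isElliptic_quadraticTwist hD0
  obtain ⟨Cd, hCd⟩ := hasGlobalMinimalModel_rat_holds (W.quadraticTwist (NumberField.discr K : ℚ))
  haveI : (Cd • W.quadraticTwist (NumberField.discr K : ℚ)).IsGloballyMinimal := hCd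
  set Wd : WeierstrassCurve ℚ := Cd • W.quadraticTwist (NumberField.discr K : ℚ) with hWd_def
  have hWd : Cd • W.quadraticTwist (NumberField.discr K : ℚ) = Wd := rfl
  have hirrd : Wd.HasIrreducibleModPGaloisRep p :=
    hasIrreducibleModPGaloisRep_twist_model W p K h2 hirr Cd hWd
  have hLt' : (W.quadraticTwist (NumberField.discr K : ℚ)).entireLFunction = Wd.entireLFunction := by
    rw [← hWd, entireLFunction_smul]
  have hLd1 : Wd.entireLFunction 1 ≠ 0 := by rw [← hLt']; exact hLt
  have hrd : Wd.analyticRank = 0 := (Wd.analyticRank_eq_zero_iff_holds (hmod Wd)).2 hLd1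
  have hfinSd : Wd.ShaFinite := (hGZK Wd (by rw [hrd]; omega)).2
  -- the twist is multiplicative at `p` (inert in `T`, or split off `T ∪ C` — `p ∉ C` since `p` is multiplicative)
  have hmultd : Wd.HasMultiplicativeReductionAtPrime p := by
    by_cases hpT : p ∈ T
    · obtain ⟨hnp, hdp⟩ := hinert p hpT
      have hJp : jacobiSym (NumberField.discr K) p = -1 :=
        jacobiSym_discr_eq_neg_one_of_ncard_ne_two h2 hp hp2 (by rw [hnp]; decide) hdp
      exact mult_twist_of_jacobiSym W K Cd hWd p hp2 hJp hmult
    · have hsq : IsSquare (algebraMap ℚ ℚ_[p] (NumberField.discr K : ℚ)) :=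
        hsplit p (WeierstrassCurve.HasMultiplicativeReduction.not_hasGoodReduction (R := ℤ_[p]) hmult) hpT
          (fun hpC ↦ hnotMultC p hpC hmult)
      have h' : (Cd • W.quadraticTwist (NumberField.discr K : ℚ)).HasMultiplicativeReductionAtPrime p := by
        rw [hasMultiplicativeReductionAtPrime_smul_iff]
        exact (hasMultiplicativeReductionAtPrime_quadraticTwist_iff W hD0 hsq).mpr hmult
      exact h'
  -- (ram) for the twist through `ℓ₀` (inert odd, inert `2`, or split; `ℓ₀ ∉ C`)
  have hℓ₀C : ℓ₀ ∉ C := fun h ↦ hnotMultC ℓ₀ h hmult₀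
  have hramd : Ram Wd p := by
    by_cases h0T : ℓ₀ ∈ T
    · obtain ⟨_, -, hcase⟩ := hTin ℓ₀ h0T
      rcases hcase with ⟨h02, hJ0⟩ | ⟨h0eq, h8⟩
      · exact ram_twist_of_inert_witness W K Cd hWd ℓ₀ h02 hJ0 p hℓ₀p hmult₀ hram₀
      · subst h0eq
        exact ram_twist_of_inert_witness_two W K Cd hWd h8 p hℓ₀p hmult₀ hram₀
    · have hsq₀ : IsSquare (algebraMap ℚ ℚ_[ℓ₀] (NumberField.discr K : ℚ)) :=
        hsplit ℓ₀ (WeierstrassCurve.HasMultiplicativeReduction.not_hasGoodReduction (R := ℤ_[ℓ₀])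
          hmult₀) h0T hℓ₀C
      refine ⟨ℓ₀, inferInstance, hℓ₀p, ?_, ?_⟩
      · rw [← hWd, hasMultiplicativeReductionAtPrime_smul_iff]
        exact (hasMultiplicativeReductionAtPrime_quadraticTwist_iff W hD0 hsq₀).mpr hmult₀
      · rwa [padicValInt_minimalDiscriminantInt_twist_eq W ℓ₀ hD0 hsq₀ Cd hWd]
  -- Skinner 2016 Thm. C for the twist
  have hp3 : 3 ≤ p := by
    have := hp.two_le
    omega
  obtain ⟨qS, hqS, hvqS⟩ := hSk Wd p hp3 (Or.inr hmultd) hirrd hramd hLd1 hfinSd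
  exact ⟨K, inferInstance, inferInstance, Wd, inferInstance, hCd, Cd, hK, hdisc, hinertTC, hsplitN, hLt, hWd,
    qS, hqS, hvqS.le⟩


end Summit.BirchSwinnertonDyer.BirchSwinnertonDyer.Theorems

end
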